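import Summits.QuantumFields.BalabanUV.T4Continuum.Support.NE7EffectiveFormLevelLimitFlat
import HarnessLib

/-!
# NE7EffectiveFormLevelLimitOperator — THE INFINITE-LEVEL LIMIT OF BAŁABAN'S FLAT-BACKGROUND EFFECTIVE QUADRATIC FORMS IS A SYMMETRIC BILINEAR FORM `Δ_∞` ON THE COARSE
# DIRECTIONS, `D²m_{j+1}(0)[v,w] → Δ_∞[v,w]` for all `v, w`, with `Σ_P ‖curl_1 ṽ‖² ≤ Δ_∞[v,v] ≤ homC 4 · Σ_P ‖curl_1 ṽ‖²` and `D²m_{j+1}(0)[v,v] ↑ Δ_∞[v,v]` (every `N`, every `U(n)`, `L ≥ 2`)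

Lineage `b2b-balaban-t4-ne7-p1` (CRUX PROVER NE7 #1 = OWNER of BINDER row NE7), generation 116; sequel of ✓ `NE7EffectiveFormLevelLimitFlat` (the diagonal `D²m_{j+1}(0)[v,v]` converges,
monotonically, to its supremum, with the two-sided Maxwell bounds).  By the symmetry of second derivatives (✓ `ContDiffAt.isSymmSndFDerivAt`, `C²` from ✓ `NE7MinActHessianFlatCurl`) and
POLARISATION `4·D²m[v,w] = D²m[v+w,v+w] − D²m[v−w,v−w]`, the off-diagonal values converge too, and the limits assemble into a real symmetric bilinear form:
**`effectiveForm_bilinear_tendsto_level_flat`**: `∃ ε₀ > 0, ∀ 0 < ε ≤ ε₀, ∀ N ≥ 1, ∃ Δ_∞ : skewSub 4 n N →ₗ[ℝ] skewSub 4 n N →ₗ[ℝ] ℝ` with `Tendsto (j ↦ D²(minAct 4 (sfClass 4 L N ε) L N (j+1) ∘ chart_1)(0)[v,w]) atTop (𝓝 (Δ_∞ v w))`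
for all `v w`, `Δ_∞ v w = Δ_∞ w v`, `D²m_{j+1}(0)[v,v] ≤ Δ_∞ v v` for every `j`, and `Σ_{P∈perWin 4 N} nhsNormSq(curl_1 ṽ P) ≤ Δ_∞ v v ≤ homC 4 · Σ_P nhsNormSq(curl_1 ṽ P)`.  [folklore]; 0 def, 0 sorry.
HONEST FRAMING: flat datum; OUR minimisers (B11 (8) with `sfClass`); the `j → ∞` limit of FIXED-coarse-lattice quadratic forms, NOT a continuum limit of the theory; nothing of Bałaban's
asserted; NOT NE7 as a spine node; spine 0∕9; NOT infinite volume, NOT mass gap, NOT BetaPertH, NOT Clay.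
-/

set_option autoImplicit false

open scoped BigOperators Matrix Matrix.Norms.L2Operator Topology
open NormedSpace Finset Filter

namespace Summit.QuantumFields.BalabanUV.T4Continuum.NE7EffectiveFormLevelLimitOperator

open Literature.MathematicalPhysics.QuantumFieldTheory.Balaban1983to89
open B7Prop1Explicit B7Prop2Explicit
open T4AveragingDeficitWall (curl)
open AveragingDeficitTorusChart (TDir chart chartDir)
open AveragingDeficitTwoLevelPrep (skewSub)
open MinimalActionLevels (perWin)
open MinimalActionSandwich (minAct)
open MinimalActionRate (sfClass)
open MinimalActionWitness (flatCfg)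
open MatrixNorms (nhsNormSq nhsNormSq_nonneg)
open NE7MinActHessianFlatCurl (minAct_hessian_flat_curl)
open NE7EffectiveFormLevelLimitFlat (effectiveForm_tendsto_level_flat)

noncomputable section

variable {n : Type} [Fintype n] [DecidableEq n]

/-- Polarisation of a symmetric continuous bilinear form: `4·B v w = B (v+w) (v+w) − B (v−w) (v−w)`. [folklore] -/
theorem polarisation {E : Type*} [NormedAddCommGroup E] [NormedSpace ℝ E] (B : E →L[ℝ] E →L[ℝ] ℝ) (hB : ∀ v w, B v w = B w v) (v w : E) :
    B v w = (B (v + w) (v + w) - B (v - w) (v - w)) / 4 := by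
  have h1 : B (v + w) (v + w) = B v v + B v w + B w v + B w w := by
    simp only [map_add, _root_.add_apply]; ring
  have h2 : B (v - w) (v - w) = B v v - B v w - B w v + B w w := by
    simp only [map_sub, _root_.sub_apply]; ring
  rw [h1, h2, hB w v]
  ring

/-- **THE LIMIT OPERATOR `Δ_∞`** (`d = 4`, every `U(n)`, `L ≥ 2`): see the file header. [folklore] -/
theorem effectiveForm_bilinear_tendsto_level_flat [Nonempty n] {L : ℕ} [NeZero L] (hL : 2 ≤ L) :
    ∃ ε₀ : ℝ, 0 < ε₀ ∧ ∀ ε : ℝ, 0 < ε → ε ≤ ε₀ → ∀ (N : ℕ) [NeZero N], 1 ≤ N →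
      ∃ Binf : ↥(skewSub 4 n N) →ₗ[ℝ] ↥(skewSub 4 n N) →ₗ[ℝ] ℝ,
        (∀ v w : ↥(skewSub 4 n N), Tendsto (fun j : ℕ => fderiv ℝ (fderiv ℝ (fun y : ↥(skewSub 4 n N) => minAct 4 (sfClass 4 L N ε) L N (j + 1)
            (chart (ContinuousLinearMap.id ℝ (Matrix n n ℂ)) N (flatCfg : Site 4 → Fin 4 → (Matrix n n ℂ)ˣ) (y : TDir 4 n N)))) 0 v w) atTop (𝓝 (Binf v w))) ∧
        (∀ v w : ↥(skewSub 4 n N), Binf v w = Binf w v) ∧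
        (∀ (j : ℕ) (v : ↥(skewSub 4 n N)), fderiv ℝ (fderiv ℝ (fun y : ↥(skewSub 4 n N) => minAct 4 (sfClass 4 L N ε) L N (j + 1)
            (chart (ContinuousLinearMap.id ℝ (Matrix n n ℂ)) N (flatCfg : Site 4 → Fin 4 → (Matrix n n ℂ)ˣ) (y : TDir 4 n N)))) 0 v v ≤ Binf v v) ∧
        (∀ v : ↥(skewSub 4 n N),
          ∑ P ∈ perWin 4 N, nhsNormSq (curl (flatCfg : Site 4 → Fin 4 → (Matrix n n ℂ)ˣ) (chartDir (ContinuousLinearMap.id ℝ (Matrix n n ℂ)) N (v : TDir 4 n N)) P) ≤ Binf v v ∧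
          Binf v v ≤ 2 * (2304 * 4 ^ 4 + 4 * (4 : ℝ) * (24 * (8 : ℝ) ^ 3) ^ 2 * ((4 : ℝ) * 2 ^ 16))
            * ∑ P ∈ perWin 4 N, nhsNormSq (curl (flatCfg : Site 4 → Fin 4 → (Matrix n n ℂ)ˣ) (chartDir (ContinuousLinearMap.id ℝ (Matrix n n ℂ)) N (v : TDir 4 n N)) P)) := by
  obtain ⟨ε₁, hε₁, H₁⟩ := effectiveForm_tendsto_level_flat (n := n) hL
  obtain ⟨ε₂, hε₂, H₂⟩ := minAct_hessian_flat_curl (n := n) hL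
  refine ⟨min ε₁ ε₂, lt_min hε₁ hε₂, fun ε hε hεle N _ hN => ?_⟩
  have hε1 : ε ≤ ε₁ := hεle.trans (min_le_left _ _)
  have hε2 : ε ≤ ε₂ := hεle.trans (min_le_right _ _)
  -- the forms `D_j`
  set D : ℕ → (↥(skewSub 4 n N) →L[ℝ] ↥(skewSub 4 n N) →L[ℝ] ℝ) := fun j => fderiv ℝ (fderiv ℝ (fun y : ↥(skewSub 4 n N) =>
    minAct 4 (sfClass 4 L N ε) L N (j + 1) (chart (ContinuousLinearMap.id ℝ (Matrix n n ℂ)) N (flatCfg : Site 4 → Fin 4 → (Matrix n n ℂ)ˣ) (y : TDir 4 n N)))) 0 with hD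
  have hsymm : ∀ j v w, D j v w = D j w v := fun j v w => ((H₂ ε hε hε2 N hN j).1.isSymmSndFDerivAt (by simp)).eq v w
  -- the diagonal limits
  have hq : ∀ v : ↥(skewSub 4 n N), ∃ q : ℝ, Tendsto (fun j => D j v v) atTop (𝓝 q) ∧ (∀ j, D j v v ≤ q) ∧
      ∑ P ∈ perWin 4 N, nhsNormSq (curl (flatCfg : Site 4 → Fin 4 → (Matrix n n ℂ)ˣ) (chartDir (ContinuousLinearMap.id ℝ (Matrix n n ℂ)) N (v : TDir 4 n N)) P) ≤ q ∧
      q ≤ 2 * (2304 * 4 ^ 4 + 4 * (4 : ℝ) * (24 * (8 : ℝ) ^ 3) ^ 2 * ((4 : ℝ) * 2 ^ 16))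
        * ∑ P ∈ perWin 4 N, nhsNormSq (curl (flatCfg : Site 4 → Fin 4 → (Matrix n n ℂ)ˣ) (chartDir (ContinuousLinearMap.id ℝ (Matrix n n ℂ)) N (v : TDir 4 n N)) P) :=
    fun v => H₁ ε hε hε1 N hN v
  choose Q hQt hQle hQlow hQup using hq
  -- polarised limit
  set B₀ : ↥(skewSub 4 n N) → ↥(skewSub 4 n N) → ℝ := fun v w => (Q (v + w) - Q (v - w)) / 4 with hB₀
  have hT : ∀ v w, Tendsto (fun j => D j v w) atTop (𝓝 (B₀ v w)) := by
    intro v w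
    have hpol : (fun j => D j v w) = fun j => (D j (v + w) (v + w) - D j (v - w) (v - w)) / 4 := funext fun j => polarisation (D j) (hsymm j) v w
    rw [hpol]
    exact ((hQt (v + w)).sub (hQt (v - w))).div_const 4
  have hdiag : ∀ v, B₀ v v = Q v := fun v => tendsto_nhds_unique (hT v v) (hQt v)
  -- bilinearity of the limit
  have hadd₂ : ∀ v w₁ w₂, B₀ v (w₁ + w₂) = B₀ v w₁ + B₀ v w₂ := fun v w₁ w₂ => by
    refine tendsto_nhds_unique (hT v (w₁ + w₂)) ?_
    have : (fun j => D j v (w₁ + w₂)) = fun j => D j v w₁ + D j v w₂ := funext fun j => by simp only [map_add]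
    rw [this]; exact (hT v w₁).add (hT v w₂)
  have hsmul₂ : ∀ (c : ℝ) v w, B₀ v (c • w) = c • B₀ v w := fun c v w => by
    refine tendsto_nhds_unique (hT v (c • w)) ?_
    have : (fun j => D j v (c • w)) = fun j => c • D j v w := funext fun j => by simp only [map_smul]
    rw [this]; exact (hT v w).const_smul c
  have hsym : ∀ v w, B₀ v w = B₀ w v := fun v w => by
    refine tendsto_nhds_unique (hT v w) ?_
    have : (fun j => D j v w) = fun j => D j w v := funext fun j => hsymm j v w
    rw [this]; exact hT w v
  have hadd₁ : ∀ v₁ v₂ w, B₀ (v₁ + v₂) w = B₀ v₁ w + B₀ v₂ w := fun v₁ v₂ w => by rw [hsym, hadd₂, hsym w v₁, hsym w v₂]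
  have hsmul₁ : ∀ (c : ℝ) v w, B₀ (c • v) w = c • B₀ v w := fun c v w => by rw [hsym, hsmul₂, hsym w v]
  refine ⟨LinearMap.mk₂ ℝ B₀ hadd₁ hsmul₁ hadd₂ hsmul₂, fun v w => hT v w, fun v w => hsym v w, fun j v => ?_, fun v => ⟨?_, ?_⟩⟩
  · show D j v v ≤ B₀ v v
    rw [hdiag]; exact hQle v j
  · show _ ≤ B₀ v v
    rw [hdiag]; exact hQlow v
  · show B₀ v v ≤ _
    rw [hdiag]; exact hQup v

end

end Summit.QuantumFields.BalabanUV.T4Continuum.NE7EffectiveFormLevelLimitOperator
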